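import Mathlib
import HarnessLib
import Literature.MathematicalPhysics.QuantumLattice.HubbardUVSymbolFibreSamplingGeometric

/-!
# The frame-shift / band-increment PIECE of the ultraviolet symbol with GEOMETRIC constants: `Ψ(ω, v + w) − Ψ(ω, v)` sampled on `(ℤ/L)²`,
# every order, one increment jet per term, one clean power of `6/max(|ω|, Λ/2)`

Topic `MathematicalPhysics/QuantumLattice`; the multi-scale companion of `HubbardUVBandPieces.incrPiece_value_le` (there: orders `≤ 3`, one-scale
constants `uvIncrQ`, `Λ ≤ 4`).  For the frame-shift response of the two-leg reading at a deep scale (cell gate-hubbard-kl, K3 engine-flow stub (C), door (B);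
Benfatto–Giuliani–Mastropietro 2006, (2.36aa), §3 (3.2)–(3.8)) the band derivative of the symbol has GEOMETRIC jets on every frequency fibre,
`‖Dⁱ(∂_{e₁}Ψ)(ω, e)‖ ≤ A·i!·ρⁱ` with `A = 2cB(2/m)²`, `ρ = 6/m`, `m = max(|ω|, Λ/2)` (from `norm_iteratedFDeriv_fbDir_uvSymbol₂_le`:
`cB(i+2)!(2/m)^{i+2}` and `(i+2)! ≤ 2·3ⁱ·i!`), so `HubbardUVSymbolFibreSamplingGeometric.norm_fwdDiff_iter₂_increment_sample_le_of_geometric` applies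
with band jets `d·ρ^{i−1}`:

* `factorial_add_two_le` — `(i+2)! ≤ 2·3ⁱ·i!`;
* `norm_iteratedFDeriv_fbDir_uvSymbol₂_fibre_le_geometric` — the geometric fibre bound above (`i + 1 ≤ N` cutoff derivatives bounded by `B ≥ 1`);
* **`incrPiece_value_le_of_geometric`** — for lattice bands `v = ṽ∘p`, `w = w̃∘p` (periodic, `C^k`) with `‖Dⁱ(ṽ + s·w̃)‖ ≤ d·(6/m)^{i−1}` (`1 ≤ i ≤ k`,
  `s ∈ [0,1]`) and `‖Dⁱw̃‖ ≤ Wᵢ` (`i ≤ k`), `k + 2 ≤ N`: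
  `‖Δ_{e_l}^aΔ_{e_{l'}}^b[Ψ(ω, v + w)](q⃗) − Δ_{e_l}^aΔ_{e_{l'}}^b[Ψ(ω, v)](q⃗)‖ ≤ (2π/L)^k·Σ_{j≤k} C(k,j)·(j!·(A·j!)·(max(d,1)·6/m)ʲ)·W_{k−j}`, `k = a + b`,
  `Ψ = uvSymbol₂ c Λ` (`c ≥ 0`; for the counterterm carrier `c = βL²`).

Everything is proved; no definitions; no named facts.

## Sources

G. Benfatto, A. Giuliani, V. Mastropietro, Ann. Henri Poincaré 7 (2006) 809–898, §2.1 (2.36aa), Lemma 2.2, §3 (3.2)–(3.8)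
(`BenfattoGiulianiMastropietro2006`); M. Salmhofer, *Renormalization* (1999), §4.2.5 (4.70) (`Salmhofer1999`).
-/

noncomputable section

namespace Literature.MathematicalPhysics.QuantumLattice

open Literature.Probability.LatticeModels Literature.Analysis.Calculus Finset Complex Set
open scoped Nat

/-! ### §1 The geometric fibre bound of `∂_{e₁}Ψ` -/

/-- `(i+2)! ≤ 2·3ⁱ·i!`. [cite: BenfattoGiulianiMastropietro2006, (2.36aa)] -/
theorem factorial_add_two_le (i : ℕ) : ((i + 2) ! : ℝ) ≤ 2 * 3 ^ i * i ! := by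
  have h : ∀ n : ℕ, ((n + 1) * (n + 2) : ℝ) ≤ 2 * 3 ^ n := by
    intro n
    induction n with
    | zero => norm_num
    | succ n ih =>
      push_cast at ih ⊢
      have h3 : (0 : ℝ) ≤ 3 ^ n := by positivity
      have hn : (0 : ℝ) ≤ n := Nat.cast_nonneg n
      rw [pow_succ]
      nlinarith [ih, h3, hn]
  have hf : ((i + 2) ! : ℝ) = (i + 1) * (i + 2) * i ! := by
    rw [show i + 2 = (i + 1) + 1 by ring, Nat.factorial_succ, Nat.factorial_succ]
    push_cast
    ring
  rw [hf]
  have hi0 : (0 : ℝ) ≤ i ! := by positivity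
  nlinarith [h i, hi0]

/-- **The band derivative of the symbol has GEOMETRIC jets on every frequency fibre**:
`‖Dⁱ(∂_{e₁}Ψ)(ω, e)‖ ≤ (2cB(2/m)²)·i!·(6/m)ⁱ`, `m = max(|ω|, Λ/2)`, for `i + 1 ≤ N`. [cite: Salmhofer1999, §4.2.5 (4.70)] -/
theorem norm_iteratedFDeriv_fbDir_uvSymbol₂_fibre_le_geometric {c Λ : ℝ} (hc : 0 ≤ c) (hΛ : 0 < Λ) {N : ℕ} {B : ℝ} (hB1 : 1 ≤ B)
    (hB : ∀ i ≤ N, ∀ t, ‖iteratedDeriv i salmhoferCutoff t‖ ≤ B) (ω e : ℝ) {i : ℕ} (hi : i + 1 ≤ N) :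
    ‖iteratedFDeriv ℝ i (fbDir (uvSymbol₂ c Λ) fbE1) (fbPt ω e)‖ ≤
      (2 * c * B * (2 / max |ω| (Λ / 2)) ^ 2) * i ! * (6 / max |ω| (Λ / 2)) ^ i := by
  have h := norm_iteratedFDeriv_fbDir_uvSymbol₂_le hc hΛ hB1 hB hi fbE1 (fbPt ω e)
  rw [norm_fbE1, one_mul, fbPt_apply_zero] at h
  set m : ℝ := max |ω| (Λ / 2) with hm
  have hm0 : 0 < m := lt_max_of_lt_right (by positivity)
  have hB0 : 0 ≤ B := zero_le_one.trans hB1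
  refine h.trans ?_
  have hfac := factorial_add_two_le i
  have h2m : 0 ≤ (2 / m) ^ (i + 2) := by positivity
  calc c * B * ((i + 2) ! : ℝ) * (2 / m) ^ (i + 2) ≤ c * B * (2 * 3 ^ i * i !) * (2 / m) ^ (i + 2) := by
        exact mul_le_mul_of_nonneg_right (mul_le_mul_of_nonneg_left hfac (mul_nonneg hc hB0)) h2m
    _ = (2 * c * B * (2 / m) ^ 2) * i ! * (6 / m) ^ i := by
        rw [pow_add, show (6 : ℝ) / m = 3 * (2 / m) by ring, mul_pow]
        ring

/-! ### §2 The sampled increment with geometric constants -/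

section Incr

variable {L : ℕ} [NeZero L]

/-- **The band INCREMENT piece at every order with geometric constants**: for `Ψ = uvSymbol₂ c Λ` (`c ≥ 0`), cutoff derivatives `≤ B` up to order
`N ≥ k + 2`, lattice bands `v = ṽ∘p`, `w = w̃∘p` (periodic, `C^k`) with interpolated jets `‖Dⁱ(ṽ + s·w̃)‖ ≤ d·(6/m)^{i−1}` (`1 ≤ i ≤ k`, `s ∈ [0,1]`,
`m = max(|ω|, Λ/2)`) and increment jets `‖Dⁱw̃‖ ≤ Wᵢ` (`i ≤ k`):
`‖Δ_{e_l}^aΔ_{e_{l'}}^b[Ψ(ω, v + w)](q⃗) − Δ_{e_l}^aΔ_{e_{l'}}^b[Ψ(ω, v)](q⃗)‖ ≤ (2π/L)^k·Σ_{j≤k} C(k,j)·(j!·(A·j!)·(max(d,1)·(6/m))ʲ)·W_{k−j}`,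
`A = 2cB(2/m)²`, `k = a + b` — ONE increment jet per term, one clean power of `6/m`. [cite: BenfattoGiulianiMastropietro2006, §3 (3.2)–(3.8)] -/
theorem incrPiece_value_le_of_geometric {c Λ : ℝ} (hc : 0 ≤ c) (hΛ : 0 < Λ) {N : ℕ} {B : ℝ} (hB1 : 1 ≤ B)
    (hB : ∀ i ≤ N, ∀ t, ‖iteratedDeriv i salmhoferCutoff t‖ ≤ B) {a b : ℕ} (hN : a + b + 2 ≤ N)
    {vt wt : EuclideanSpace ℝ (Fin 2) → ℝ} (hvt : ContDiff ℝ (↑(a + b : ℕ)) vt) (hwt : ContDiff ℝ (↑(a + b : ℕ)) wt)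
    (hperv : ∀ (p : Fin 2 → ℝ) (z : Fin 2 → ℤ), vt (WithLp.toLp 2 (fun i => p i + z i * (2 * Real.pi))) = vt (WithLp.toLp 2 p))
    (hperw : ∀ (p : Fin 2 → ℝ) (z : Fin 2 → ℤ), wt (WithLp.toLp 2 (fun i => p i + z i * (2 * Real.pi))) = wt (WithLp.toLp 2 p))
    (ω : ℝ) {d : ℝ}
    (hD : ∀ s ∈ Icc (0 : ℝ) 1, ∀ i, 1 ≤ i → i ≤ a + b → ∀ x,
      ‖iteratedFDeriv ℝ i (fun x => vt x + s * wt x) x‖ ≤ d * (6 / max |ω| (Λ / 2)) ^ (i - 1))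
    {W : ℕ → ℝ} (hW : ∀ i ≤ a + b, ∀ x, ‖iteratedFDeriv ℝ i wt x‖ ≤ W i) (l l' : Fin 2) (qv : TorusSite 2 L) :
    ‖(_root_.fwdDiff (Pi.single l (1 : ZMod L) : TorusSite 2 L))^[a] ((_root_.fwdDiff (Pi.single l' (1 : ZMod L) : TorusSite 2 L))^[b]
          (fun y => uvSymbol₂ c Λ (fbPt ω (vt (WithLp.toLp 2 (latticeMomentum L y)) + wt (WithLp.toLp 2 (latticeMomentum L y)))))) qv -
        (_root_.fwdDiff (Pi.single l (1 : ZMod L) : TorusSite 2 L))^[a] ((_root_.fwdDiff (Pi.single l' (1 : ZMod L) : TorusSite 2 L))^[b]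
          (fun y => uvSymbol₂ c Λ (fbPt ω (vt (WithLp.toLp 2 (latticeMomentum L y)))))) qv‖ ≤
      (2 * Real.pi / L) ^ (a + b) *
        ∑ j ∈ Finset.range (a + b + 1), ((a + b).choose j : ℝ) *
          (j ! * ((2 * c * B * (2 / max |ω| (Λ / 2)) ^ 2) * j !) * (max d 1 * (6 / max |ω| (Λ / 2))) ^ j) * W (a + b - j) := by
  have hm0 : 0 < max |ω| (Λ / 2) := lt_max_of_lt_right (by positivity)
  have hρ : 0 < 6 / max |ω| (Λ / 2) := div_pos (by norm_num) hm0
  have hg : ContDiff ℝ (((a + b : ℕ) : ℕ∞) + 1) (uvSymbol₂ c Λ) := contDiff_uvSymbol₂ c hΛ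
  have hA : ∀ e : ℝ, ∀ i ≤ a + b, ‖iteratedFDeriv ℝ i (fbDir (uvSymbol₂ c Λ) fbE1) (fbPt ω e)‖ ≤
      (2 * c * B * (2 / max |ω| (Λ / 2)) ^ 2) * i ! * (6 / max |ω| (Λ / 2)) ^ i :=
    fun e i hi => norm_iteratedFDeriv_fbDir_uvSymbol₂_fibre_le_geometric hc hΛ hB1 hB ω e (by omega)
  exact norm_fwdDiff_iter₂_increment_sample_le_of_geometric (L := L) hg hvt hwt hperv hperw ω hρ hA hD hW l l' qv

end Incr

end Literature.MathematicalPhysics.QuantumLattice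

end
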